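import Summits.BirchSwinnertonDyer.BirchSwinnertonDyer.Theorems.ManinLocalTwoThreeShimuraQuotientCyclic
import HarnessLib

/-!
# THE SHIMURA KERNEL OF EVERY NEWFORM QUOTIENT IS CYCLIC UP TO AN ELEMENTARY 2-GROUP — part 2 of 2 (§7–§9)

Route `ManinLocalTwoThree`, crux C3 (stmt-BirchSwinnertonDyer-22968); cell bsd-f2-manin, LENS imc gen 40, MEMO-imc §52; TURNKEY T-imc-52 (sha16 f3fa9a583428a19f), second half, landed by p1 gen 25; sequel of `…ShimuraQuotientCyclic` (§1–§6).
THIS PART: §7 CRT lifts inside `Γ₀(N)`; two coprime minus divisors or Fricke sign `+1` kill `2·(Λ₀/Λ₁)`; §7b the `2`-power minus divisor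
(`(ℤ/2^v)ˣ = ±⟨5⟩`); §8 **THEOREM 52.A** `twoShimuraQuotientCyclic_of_newform` — `2·(Λ₀(f)/Λ₁(f))` is CYCLIC for every newform `f ∈ S₂(Γ₀(N))`
(any level, any coefficient field) and **52.A′** `fricke_neg_and_unique_minus_of_not_two_mul_le`; §9 the laws in closed form (`@[conjecture]` Props
DISCHARGED here by their `_holds` theorems, so that routes can credit them BY NAME).  HONEST FRAMING: unconditional theorems about the tree's
period lattices of a bare newform; no named fact, no sorry; C2/C3 (OPEN ⟸ CDT), Manin's conjecture and BSD are NOT proved.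
[cite: AtkinLehner1970, §2 Lemmas 8–10, Thm. 3] [cite: Manin1972, Prop. 1.4, Thm. 1.6]
-/

set_option autoImplicit false
-- lint-debt: the directory name repeats the summit name (sibling precedent `ManinLocalTwoThreeShimuraQuotientCyclic.lean`)
set_option linter.dupNamespace false

noncomputable section

open scoped MatrixGroups ModularForm
open CongruenceSubgroup
open Literature.NumberTheory.EllipticCurves Literature.NumberTheory.EllipticCurves.ModularForms
open Summit.BirchSwinnertonDyer.Rank1Residual.ManinAdditive.KatoCurve
open Summit.BirchSwinnertonDyer.BirchSwinnertonDyer.Theorems.ManinLocalTwoThree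
open Summit.BirchSwinnertonDyer.BirchSwinnertonDyer.Theorems.ManinLocalTwoThree.SigmaHabitat

namespace Summit.BirchSwinnertonDyer.BirchSwinnertonDyer.Theorems.ManinLocalTwoThree.ShimuraQuotientCyclic

variable {N : ℕ} [NeZero N] (f : CuspForm (Gamma0 N) 2) (Q : ℕ) [NeZero Q]

/-! ### §7  CRT lifts; two minus divisors or Fricke sign `+1` kill `2·(Λ₀/Λ₁)` -/

omit [NeZero Q] in
/-- CRT lift of the lower-right entry inside `Γ₀(N)`: `N = A·B`, `(A,B) = 1`, `(t,B) = 1` ⟹ some `γ₁ ∈ Γ₀(N)` has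
`d_{γ₁} ≡ d_γ (mod A)` and `d_{γ₁} ≡ t (mod B)` (pattern of the tree's two-minus-divisors proof, made a lemma). [folklore] -/
theorem exists_gamma0_apply_one_one_crt' (A B : ℕ) (hN : N = A * B) (hc : Nat.Coprime A B) (γ : Gamma0 N)
    (t : ℤ) (ht : IsCoprime t (B : ℤ)) :
    ∃ γ₁ : Gamma0 N, (A : ℤ) ∣ ((γ₁ : SL(2, ℤ)) 1 1 : ℤ) - ((γ : SL(2, ℤ)) 1 1 : ℤ) ∧
      (B : ℤ) ∣ ((γ₁ : SL(2, ℤ)) 1 1 : ℤ) - t := by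
  have hNQM : (N : ℤ) = A * B := by exact_mod_cast hN
  obtain ⟨α, β, hαβ⟩ := Nat.isCoprime_iff_coprime.mpr hc
  set d : ℤ := (γ : SL(2, ℤ)) 1 1 with hdd
  set x : ℤ := d * (β * B) + t * (α * A) with hx
  have hxQ : (A : ℤ) ∣ x - d := ⟨α * (t - d), by rw [hx]; linear_combination d * hαβ⟩
  have hxM : (B : ℤ) ∣ x - t := ⟨β * (d - t), by rw [hx]; linear_combination t * hαβ⟩
  have hunitN : IsUnit ((x : ℤ) : ZMod N) := by
    rw [ZMod.coe_int_isUnit_iff_isCoprime]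
    have hdN : IsCoprime (d : ℤ) (N : ℤ) := by
      rw [isCoprime_comm]; exact (ZMod.coe_int_isUnit_iff_isCoprime d N).mp (isUnit_apply_one_one γ)
    have hdQM : IsCoprime (d : ℤ) ((A : ℤ) * B) := hNQM ▸ hdN
    have hQ1x : IsCoprime (A : ℤ) x := by
      obtain ⟨k, hk⟩ := hxQ
      have e : x = d + A * k := by linear_combination hk
      rw [e]
      exact hdQM.of_mul_right_left.symm.add_mul_left_right k
    have hM1x : IsCoprime (B : ℤ) x := by
      obtain ⟨k, hk⟩ := hxM
      have e : x = t + B * k := by linear_combination hk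
      rw [e]
      exact ht.symm.add_mul_left_right k
    rw [hNQM]
    exact hQ1x.mul_left hM1x
  obtain ⟨γ₁, hγ₁⟩ := exists_gamma0_apply_one_one_eq_of_isUnit hunitN
  have hγ₁x : (N : ℤ) ∣ x - ((γ₁ : SL(2, ℤ)) 1 1 : ℤ) := (ZMod.intCast_eq_intCast_iff_dvd_sub _ _ N).mp hγ₁
  have hNQ₁ : (A : ℤ) ∣ (N : ℤ) := ⟨B, hNQM⟩
  have hNM₁ : (B : ℤ) ∣ (N : ℤ) := ⟨A, by rw [hNQM]; ring⟩
  refine ⟨γ₁, ?_, ?_⟩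
  · have e : ((γ₁ : SL(2, ℤ)) 1 1 : ℤ) - d = (x - d) - (x - ((γ₁ : SL(2, ℤ)) 1 1 : ℤ)) := by ring
    rw [e]; exact dvd_sub hxQ (hNQ₁.trans hγ₁x)
  · have e : ((γ₁ : SL(2, ℤ)) 1 1 : ℤ) - t = (x - t) - (x - ((γ₁ : SL(2, ℤ)) 1 1 : ℤ)) := by ring
    rw [e]; exact dvd_sub hxM (hNM₁.trans hγ₁x)

omit [NeZero Q] in
/-- The case `t = 1` of the CRT lift (used by §52.7). -/
theorem exists_gamma0_apply_one_one_crt (A B : ℕ) (hN : N = A * B) (hc : Nat.Coprime A B) (γ : Gamma0 N) :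
    ∃ γ₁ : Gamma0 N, (A : ℤ) ∣ ((γ₁ : SL(2, ℤ)) 1 1 : ℤ) - ((γ : SL(2, ℤ)) 1 1 : ℤ) ∧
      (B : ℤ) ∣ ((γ₁ : SL(2, ℤ)) 1 1 : ℤ) - 1 :=
  exists_gamma0_apply_one_one_crt' A B hN hc γ 1 isCoprime_one_left

omit [NeZero Q] in
/-- **§52.7 (TWO MINUS DIVISORS KILL `2·(Λ₀/Λ₁)`, PROVED, fact-free).** `Q₁, Q₂ ∥ N` coprime with `w_{Q₁} f = w_{Q₂} f = −f` ⟹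
`2Λ₀(f) ⊆ Λ₁(f)` (sharpens the tree's `4Λ₀ ⊆ Λ₁`, `four_mul_cuspSymbol_mem_of_two_atkinLehner_eq_neg`): `2{∞,γ∞} ≡ 2{∞,γ₁∞}` for
`d_{γ₁} ≡ d_γ (mod Q₁)` (§52.1), and choosing `d_{γ₁} ≡ 1 (mod Q₂)` the right side is in `Λ₁` (minus parity at `Q₂`). [cite: AtkinLehner1970, Thm. 3 (shape)] -/
theorem two_mul_mem_of_two_atkinLehner_minus (Q₁ Q₂ : ℕ) [NeZero Q₁] [NeZero Q₂]
    (h₁ : Q₁ ∣ N) (hc₁ : Nat.Coprime Q₁ (N / Q₁)) (hQ₁ : 1 < Q₁)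
    (h₂ : Q₂ ∣ N) (hc₂ : Nat.Coprime Q₂ (N / Q₂)) (hQ₂ : 1 < Q₂) (hcop : Nat.Coprime Q₁ Q₂)
    (hε₁ : atkinLehnerInvolution N 2 Q₁ f = (-1 : ℂ) • f) (hε₂ : atkinLehnerInvolution N 2 Q₂ f = (-1 : ℂ) • f) :
    ∀ z ∈ periodLattice f, 2 * z ∈ periodLatticeGamma1 f := by
  intro z hz
  have hz' : z ∈ (periodLattice f : Set ℂ) := hz
  rw [coe_periodLattice_eq_range] at hz'
  obtain ⟨γ, rfl⟩ := hz'
  obtain ⟨γ₁, hA, hB⟩ := exists_gamma0_apply_one_one_crt (N / Q₂) Q₂ (Nat.div_mul_cancel h₂).symm hc₂.symm γ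
  have hQ₁M : Q₁ ∣ N / Q₂ :=
    hcop.dvd_of_dvd_mul_left (by rw [Nat.mul_div_cancel' h₂]; exact h₁)
  have hQ₁M' : (Q₁ : ℤ) ∣ ((N / Q₂ : ℕ) : ℤ) := by exact_mod_cast hQ₁M
  have h11 : ((((γ : SL(2, ℤ)) 1 1 : ℤ)) : ZMod Q₁) = ((((γ₁ : SL(2, ℤ)) 1 1 : ℤ)) : ZMod Q₁) :=
    (ZMod.intCast_eq_intCast_iff_dvd_sub _ _ Q₁).mpr (hQ₁M'.trans hA)
  have hfac := two_mul_sub_mem_of_atkinLehner_minus_of_castEq f Q₁ h₁ hc₁ hQ₁ hε₁ γ γ₁ h11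
  have h2γ₁ := two_mul_cuspSymbol_mem_periodLatticeGamma1_of_atkinLehner_minus f Q₂ h₂ hc₂ hQ₂ hε₂ γ₁ hB
  have e : 2 * cuspSymbol f γ = 2 * cuspSymbol f γ₁ - 2 * (cuspSymbol f γ₁ - cuspSymbol f γ) := by ring
  rw [e]
  exact sub_mem h2γ₁ hfac

omit [NeZero Q] in
/-- **§52.7′ (FRICKE SIGN `+1` KILLS `2·(Λ₀/Λ₁)`, PROVED, fact-free).** `w_N f = f` ⟹ `2Λ₀(f) ⊆ Λ₁(f)` — the plus half of the
tree's Atkin–Lehner parity at `Q = N` (`d ≡ 1 (mod N/N)` is empty). So `2·(Λ₀/Λ₁) ≠ 0` forces `ε_N = −1` (even analytic rank for the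
quotient `A_f`). [cite: AtkinLehner1970, Thm. 3 (shape)] -/
theorem two_mul_mem_of_fricke_plus (hε : atkinLehnerInvolution N 2 N f = (1 : ℂ) • f) :
    ∀ z ∈ periodLattice f, 2 * z ∈ periodLatticeGamma1 f := by
  intro z hz
  have hz' : z ∈ (periodLattice f : Set ℂ) := hz
  rw [coe_periodLattice_eq_range] at hz'
  obtain ⟨γ, rfl⟩ := hz'
  by_cases hN1 : N = 1
  · subst hN1
    have h1 : cuspSymbol f 1 = 0 := by
      have h := cuspSymbol_mul_holds f 1 1
      rw [mul_one] at h
      linear_combination -h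
    have h := cuspSymbol_sub_mem_periodLatticeGamma1_of_apply_eq f 1 γ (Subsingleton.elim _ _)
    rw [h1, sub_zero] at h
    rw [two_mul]
    exact add_mem h h
  · have hN : 1 < N := by have := NeZero.pos N; omega
    have hcN : Nat.Coprime N (N / N) := by rw [Nat.div_self (NeZero.pos N)]; exact Nat.coprime_one_right N
    exact two_mul_cuspSymbol_mem_periodLatticeGamma1_of_atkinLehner_plus f N dvd_rfl hcN hN hε γ
      (by rw [Nat.div_self (NeZero.pos N), Nat.cast_one]; exact one_dvd _)

/-! ### §7b  `±`-generators: the `2`-power minus divisor -/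

/-- **§52.2♭ (ONE `±`-GENERATOR SUFFICES, PROVED).** `Q ∥ N`, `w_Q f = −f`, and an integer `g` prime to `Q` such that every `d`
prime to `Q` is `≡ ±g^k (mod Q)` ⟹ `2·(Λ₀/Λ₁)` has one generator (as §52.2, using `{∞,(−γ)∞} = {∞,γ∞}` for the sign). -/
theorem exists_two_mul_sub_zsmul_mem_of_atkinLehner_minus_of_negGenerator (hQN : Q ∣ N) (hc : Nat.Coprime Q (N / Q))
    (hQ : 1 < Q) (hε : atkinLehnerInvolution N 2 Q f = (-1 : ℂ) • f) (g : ℤ) (hg : IsCoprime g (Q : ℤ))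
    (hgen : ∀ d : ℤ, IsCoprime d (Q : ℤ) → ∃ k : ℕ, (Q : ℤ) ∣ g ^ k - d ∨ (Q : ℤ) ∣ g ^ k + d) :
    ∃ x₀ ∈ periodLattice f, ∀ z ∈ periodLattice f, ∃ k : ℤ, 2 * z - (k : ℂ) * x₀ ∈ periodLatticeGamma1 f := by
  obtain ⟨γ₀, -, hγ₀⟩ :=
    exists_gamma0_apply_one_one_crt' (N / Q) Q (Nat.div_mul_cancel hQN).symm hc.symm (1 : Gamma0 N) g hg
  refine ⟨cuspSymbol f γ₀, cuspSymbol_mem_periodLattice f γ₀, fun z hz => ?_⟩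
  have hz' : z ∈ (periodLattice f : Set ℂ) := hz
  rw [coe_periodLattice_eq_range] at hz'
  obtain ⟨γ, rfl⟩ := hz'
  have hQN' : (Q : ℤ) ∣ (N : ℤ) := by exact_mod_cast hQN
  have hdcop : IsCoprime ((γ : SL(2, ℤ)) 1 1 : ℤ) (Q : ℤ) :=
    (isCoprime_comm.mp ((ZMod.coe_int_isUnit_iff_isCoprime _ N).mp (isUnit_apply_one_one γ))).of_isCoprime_of_dvd_right hQN'
  obtain ⟨n, hn⟩ := hgen _ hdcop
  have hpow : (((((γ₀ ^ n : Gamma0 N)) : SL(2, ℤ)) 1 1 : ℤ) : ZMod Q) = (((g : ℤ) : ZMod Q)) ^ n := by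
    rw [apply_one_one_pow_castEq γ₀ hQN n, ← ((ZMod.intCast_eq_intCast_iff_dvd_sub g _ Q).mpr hγ₀)]
  rcases hn with h | h
  · have hcast : (((((γ₀ ^ n : Gamma0 N)) : SL(2, ℤ)) 1 1 : ℤ) : ZMod Q) = (((((γ : SL(2, ℤ)) 1 1 : ℤ)) : ZMod Q)) := by
      have e := (ZMod.intCast_eq_intCast_iff_dvd_sub _ _ Q).mpr h
      push_cast at e
      rw [hpow]; exact e.symm
    have key := two_mul_sub_mem_of_atkinLehner_minus_of_castEq f Q hQN hc hQ hε (γ₀ ^ n) γ hcast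
    rw [cuspSymbol_pow_eq_natCast_mul] at key
    refine ⟨2 * n, ?_⟩
    push_cast
    convert key using 1
    ring
  · obtain ⟨δ, -, -, h11, hδ⟩ := exists_neg_entries_cuspSymbol_eq f γ
    have hcast : (((((γ₀ ^ n : Gamma0 N)) : SL(2, ℤ)) 1 1 : ℤ) : ZMod Q) = (((((δ : SL(2, ℤ)) 1 1 : ℤ)) : ZMod Q)) := by
      have e := (ZMod.intCast_eq_intCast_iff_dvd_sub (-((γ : SL(2, ℤ)) 1 1 : ℤ)) _ Q).mpr (by rwa [sub_neg_eq_add])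
      push_cast at e
      rw [hpow, h11]; push_cast; exact e.symm
    have key := two_mul_sub_mem_of_atkinLehner_minus_of_castEq f Q hQN hc hQ hε (γ₀ ^ n) δ hcast
    rw [cuspSymbol_pow_eq_natCast_mul, hδ] at key
    refine ⟨2 * n, ?_⟩
    push_cast
    convert key using 1
    ring

omit [NeZero N] [NeZero Q] in
/-- `5^{2^m} = 1 + 2^{m+2} + t·2^{m+3}`. [folklore] -/
theorem five_pow_two_pow_eq (m : ℕ) : ∃ t : ℤ, (5 : ℤ) ^ (2 ^ m) = 1 + 2 ^ (m + 2) + t * 2 ^ (m + 3) := by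
  induction m with
  | zero => exact ⟨0, by norm_num⟩
  | succ m ih =>
    obtain ⟨t, ht⟩ := ih
    refine ⟨2 ^ m + t + t * 2 ^ (m + 2) + t ^ 2 * 2 ^ (m + 2), ?_⟩
    rw [show (5 : ℤ) ^ (2 ^ (m + 1)) = ((5 : ℤ) ^ (2 ^ m)) ^ 2 by rw [pow_succ, pow_mul], ht]
    ring

omit [NeZero N] [NeZero Q] in
/-- `5` generates the residues `≡ 1 (mod 4)` modulo every `2^{m+2}`: `d ≡ 1 (mod 4)` ⟹ `d ≡ 5^k (mod 2^{m+2})`. [folklore] -/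
theorem exists_two_pow_dvd_five_pow_sub (m : ℕ) : ∀ d : ℤ, (4 : ℤ) ∣ d - 1 → ∃ k : ℕ, (2 : ℤ) ^ (m + 2) ∣ 5 ^ k - d := by
  induction m with
  | zero =>
    intro d hd
    exact ⟨0, by norm_num; exact dvd_sub_comm.mp hd⟩
  | succ m ih =>
    intro d hd
    obtain ⟨k, s, hs⟩ := ih d hd
    rcases Int.even_or_odd s with ⟨r, hr⟩ | hso
    · exact ⟨k, r, by rw [hs, hr]; ring⟩
    · obtain ⟨t, ht⟩ := five_pow_two_pow_eq m
      have h5odd : Odd ((5 : ℤ) ^ k) := Odd.pow ⟨2, by norm_num⟩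
      obtain ⟨r, hr⟩ : Even (s + 5 ^ k * (1 + 2 * t)) := Odd.add_odd hso (h5odd.mul ⟨t, by ring⟩)
      refine ⟨k + 2 ^ m, r, ?_⟩
      rw [pow_add, ht]
      linear_combination hs + 2 ^ (m + 2) * hr

/-- **§52.2♯ (THE `2`-POWER MINUS DIVISOR, PROVED).** `Q = 2^v ∥ N` (`v ≥ 1`), `w_Q f = −f` ⟹ `2·(Λ₀/Λ₁)` has one generator
(`(ℤ/2^v)ˣ = ±⟨5⟩`). -/
theorem exists_two_mul_sub_zsmul_mem_of_atkinLehner_minus_twoPow {v : ℕ} (hv : 0 < v) (hQ : 2 ^ v = Q) (hQN : Q ∣ N)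
    (hc : Nat.Coprime Q (N / Q)) (hε : atkinLehnerInvolution N 2 Q f = (-1 : ℂ) • f) :
    ∃ x₀ ∈ periodLattice f, ∀ z ∈ periodLattice f, ∃ k : ℤ, 2 * z - (k : ℂ) * x₀ ∈ periodLatticeGamma1 f := by
  have h1Q : 1 < Q := hQ ▸ Nat.one_lt_pow hv.ne' (by norm_num)
  have hQZ : (Q : ℤ) = 2 ^ v := by rw [← hQ]; push_cast; rfl
  have hg : IsCoprime (5 : ℤ) (Q : ℤ) := by
    have h : IsCoprime ((5 : ℕ) : ℤ) ((2 ^ v : ℕ) : ℤ) := Nat.isCoprime_iff_coprime.mpr (Nat.Coprime.pow_right _ (by norm_num))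
    rw [hQ] at h
    simpa only [Nat.cast_ofNat] using h
  refine exists_two_mul_sub_zsmul_mem_of_atkinLehner_minus_of_negGenerator f Q hQN hc h1Q hε 5 hg fun d hd => ?_
  have h2Q : (2 : ℤ) ∣ (Q : ℤ) := by rw [hQZ]; exact dvd_pow_self 2 hv.ne'
  have hodd : ¬ (2 : ℤ) ∣ d := fun h2d => by
    rcases Int.isUnit_iff.mp (hd.isUnit_of_dvd' h2d h2Q) with h | h <;> norm_num at h
  have hdvQ : (Q : ℤ) ∣ (2 : ℤ) ^ (v - 2 + 2) := by rw [hQZ]; exact pow_dvd_pow 2 (by omega)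
  rcases (show (4 : ℤ) ∣ d - 1 ∨ (4 : ℤ) ∣ -d - 1 by omega) with h4 | h4
  · obtain ⟨k, hk⟩ := exists_two_pow_dvd_five_pow_sub (v - 2) d h4
    exact ⟨k, Or.inl (hdvQ.trans hk)⟩
  · obtain ⟨k, hk⟩ := exists_two_pow_dvd_five_pow_sub (v - 2) (-d) h4
    exact ⟨k, Or.inr (hdvQ.trans (by rwa [sub_neg_eq_add] at hk))⟩

/-! ### §8  THEOREM 52.A: `2·(Λ₀/Λ₁)` is cyclic for newforms -/

omit [NeZero Q] in
/-- **THEOREM 52.A (PROVED, fact-free; every newform `f ∈ S₂(Γ₀(N))`, any level, any coefficient field).** `2·(Λ₀(f)/Λ₁(f))` is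
CYCLIC: there is `x₀ ∈ Λ₀` with `2Λ₀ ⊆ ℤx₀ + Λ₁`.  Proof: `ε_N = +1` ⟹ `2Λ₀ ⊆ Λ₁` (§52.7′); `ε_N = −1 = ∏ λ_q` (Atkin–Lehner product
formula, tree) ⟹ some `λ_q = −1`; `q` odd ⟹ §52.2′ (`(ℤ/q^e)ˣ` cyclic); `q = 2` ⟹ §52.2♯ (`(ℤ/2^e)ˣ = ±⟨5⟩`).  By the dictionary
(NOTE-52 §0) this says: `2·ker(λ : A_f^{(1)} → A_f)` is a CYCLIC group scheme quotient for every newform quotient `A_f` of `J₀(N)`,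
`dim A_f` arbitrary; with §52.C the whole Shimura kernel is cyclic up to an elementary `2`-group. -/
theorem twoShimuraQuotientCyclic_of_newform (hf : IsNewform0 f) : TwoShimuraQuotientCyclic f := by
  have triv : (∀ z ∈ periodLattice f, 2 * z ∈ periodLatticeGamma1 f) → TwoShimuraQuotientCyclic f :=
    fun h => ⟨0, zero_mem _, fun z hz => ⟨0, by simpa using h z hz⟩⟩
  have hN0 : N ≠ 0 := NeZero.ne N
  have hf0 : f ≠ 0 := fun h0 ↦ hf.coe_ne_zero (by rw [h0]; rfl)
  -- Fricke sign
  obtain ⟨ε, hε1, hεF⟩ := IsNewform0.exists_frickeInvolution_eq_smul_holds hf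
  have hεA : atkinLehnerInvolution N 2 N f = ε • f := by
    rw [atkinLehnerInvolution_self_eq_frickeInvolution N 2 f]; exact hεF
  rcases hε1 with rfl | rfl
  · exact triv (two_mul_mem_of_fricke_plus f hεA)
  · -- `ε_N = −1 = ∏ λ_q`: some `λ_q = −1`
    have hfe : frickeEigenvalue f = -1 := by
      have h := frickeInvolution_eq_frickeEigenvalue_smul ⟨-1, hεF⟩
      rw [hεF] at h
      have h0 : (frickeEigenvalue f - (-1)) • f = 0 := by rw [sub_smul, ← h, sub_self]
      rcases smul_eq_zero.mp h0 with h0 | h0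
      · linear_combination h0
      · exact absurd h0 hf0
    have hprod : frickeEigenvalue f = ∏ p ∈ N.primeFactors, atkinLehnerEigenvalueAt f p :=
      IsNewform0.frickeEigenvalue_eq_prod_atkinLehnerEigenvalueAt_holds hf
    obtain ⟨q, hq, hεq⟩ : ∃ q ∈ N.primeFactors, atkinLehnerEigenvalueAt f q = -1 := by
      by_contra hne
      push Not at hne
      have h1 : ∏ p ∈ N.primeFactors, atkinLehnerEigenvalueAt f p = 1 :=
        Finset.prod_eq_one fun p hp =>
          (hf.atkinLehnerEigenvalueAt_eq_one_or_eq_neg_one (Nat.prime_of_mem_primeFactors hp)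
            (Nat.dvd_of_mem_primeFactors hp)).resolve_right (hne p hp)
      rw [← hprod, hfe] at h1
      norm_num at h1
    have hqp := Nat.prime_of_mem_primeFactors hq
    have hkpos : 0 < N.factorization q := Nat.Prime.factorization_pos_of_dvd hqp hN0 (Nat.dvd_of_mem_primeFactors hq)
    haveI : NeZero (q ^ N.factorization q) := ⟨pow_ne_zero _ hqp.ne_zero⟩
    have hQN : q ^ N.factorization q ∣ N := Nat.ordProj_dvd N q
    have hcop : Nat.Coprime (q ^ N.factorization q) (N / q ^ N.factorization q) :=
      Nat.Coprime.pow_left _ (Nat.coprime_ordCompl hqp hN0)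
    have hinv : atkinLehnerInvolution N 2 (q ^ N.factorization q) f = (-1 : ℂ) • f :=
      atkinLehnerInvolution_eq_neg_of_eigenvalueAt f rfl hεq
    by_cases hq2 : q = 2
    · subst hq2
      exact exists_two_mul_sub_zsmul_mem_of_atkinLehner_minus_twoPow f _ hkpos rfl hQN hcop hinv
    · exact exists_two_mul_sub_zsmul_mem_of_atkinLehner_minus_primePow f _ hqp hq2 hkpos rfl hQN hcop hinv

omit [NeZero Q] in
/-- **COROLLARY 52.A′ (PROFILE, PROVED).** For a newform: `2Λ₀ ⊆ Λ₁` unless `ε_N = −1`; and two distinct Atkin–Lehner-minus primes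
also force `2Λ₀ ⊆ Λ₁`.  Hence `2·(Λ₀/Λ₁) ≠ 0` ⟹ `w_N f = −f` and EXACTLY ONE prime `q ∣ N` has `λ_q(f) = −1`. -/
theorem fricke_neg_and_unique_minus_of_not_two_mul_le (hf : IsNewform0 f)
    (h : ¬ ∀ z ∈ periodLattice f, 2 * z ∈ periodLatticeGamma1 f) :
    atkinLehnerInvolution N 2 N f = (-1 : ℂ) • f ∧
      ∀ q₁ ∈ N.primeFactors, ∀ q₂ ∈ N.primeFactors, atkinLehnerEigenvalueAt f q₁ = -1 →
        atkinLehnerEigenvalueAt f q₂ = -1 → q₁ = q₂ := by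
  have hN0 : N ≠ 0 := NeZero.ne N
  obtain ⟨ε, hε1, hεF⟩ := IsNewform0.exists_frickeInvolution_eq_smul_holds hf
  have hεA : atkinLehnerInvolution N 2 N f = ε • f := by
    rw [atkinLehnerInvolution_self_eq_frickeInvolution N 2 f]; exact hεF
  refine ⟨?_, fun q₁ hq₁ q₂ hq₂ hε₁ hε₂ => ?_⟩
  · rcases hε1 with rfl | rfl
    · exact absurd (two_mul_mem_of_fricke_plus f hεA) h
    · exact hεA
  · by_contra hne
    have hq₁p := Nat.prime_of_mem_primeFactors hq₁
    have hq₂p := Nat.prime_of_mem_primeFactors hq₂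
    haveI : NeZero (q₁ ^ N.factorization q₁) := ⟨pow_ne_zero _ hq₁p.ne_zero⟩
    haveI : NeZero (q₂ ^ N.factorization q₂) := ⟨pow_ne_zero _ hq₂p.ne_zero⟩
    have hk₁ : 0 < N.factorization q₁ := Nat.Prime.factorization_pos_of_dvd hq₁p hN0 (Nat.dvd_of_mem_primeFactors hq₁)
    have hk₂ : 0 < N.factorization q₂ := Nat.Prime.factorization_pos_of_dvd hq₂p hN0 (Nat.dvd_of_mem_primeFactors hq₂)
    exact h (two_mul_mem_of_two_atkinLehner_minus f (q₁ ^ N.factorization q₁) (q₂ ^ N.factorization q₂)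
      (Nat.ordProj_dvd N q₁) (Nat.Coprime.pow_left _ (Nat.coprime_ordCompl hq₁p hN0)) (Nat.one_lt_pow hk₁.ne' hq₁p.one_lt)
      (Nat.ordProj_dvd N q₂) (Nat.Coprime.pow_left _ (Nat.coprime_ordCompl hq₂p hN0)) (Nat.one_lt_pow hk₂.ne' hq₂p.one_lt)
      (Nat.coprime_pow_primes _ _ hq₁p hq₂p hne)
      (atkinLehnerInvolution_eq_neg_of_eigenvalueAt f rfl hε₁) (atkinLehnerInvolution_eq_neg_of_eigenvalueAt f rfl hε₂))


/-! ## §9 THE LAWS IN CLOSED FORM (universally quantified, DISCHARGED here — credited by name) -/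

omit [NeZero N] [NeZero Q] in
/-- **LAW 52.A (closed form): for every level `N` and every newform `f ∈ S₂(Γ₀(N))`, `2·(Λ₀(f)/Λ₁(f))` is cyclic.**  DISCHARGED below
(`twoShimuraQuotientCyclicLaw_holds`); typed as a named Prop only so that routes can credit it BY NAME.  Not in print in this form for
coefficient fields of degree `d ≥ 2` (NOTE-52 §5); mechanism = Atkin–Lehner relations on the cusp character. -/
@[conjecture]
def TwoShimuraQuotientCyclicLaw : Prop :=
  ∀ (N : ℕ) [NeZero N] (f : CuspForm (Gamma0 N) 2), IsNewform0 f → TwoShimuraQuotientCyclic f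

omit [NeZero N] [NeZero Q] in
/-- `twoShimuraQuotientCyclicLaw_holds`: the closed-form law above HOLDS — discharged by the corresponding theorem of §3–§8. [folklore] -/
theorem twoShimuraQuotientCyclicLaw_holds : TwoShimuraQuotientCyclicLaw := by
  intro N _ f hf
  exact twoShimuraQuotientCyclic_of_newform f hf

omit [NeZero N] [NeZero Q] in
/-- **LAW 52.C (closed form): for every level, every newform and every odd prime `ℓ`, `(Λ₀(f)/Λ₁(f)) ⊗ 𝔽_ℓ` is cyclic — the odd part of the
Shimura quotient is cyclic.**  DISCHARGED below (`oddShimuraQuotientCyclicLaw_holds`). -/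
@[conjecture]
def OddShimuraQuotientCyclicLaw : Prop :=
  ∀ (N : ℕ) [NeZero N] (f : CuspForm (Gamma0 N) 2), IsNewform0 f →
    ∀ ℓ : ℕ, ℓ.Prime → ℓ ≠ 2 → OddShimuraQuotientCyclic f ℓ

omit [NeZero N] [NeZero Q] in
/-- `oddShimuraQuotientCyclicLaw_holds`: the closed-form law above HOLDS — discharged by the corresponding theorem of §3–§8. [folklore] -/
theorem oddShimuraQuotientCyclicLaw_holds : OddShimuraQuotientCyclicLaw := by
  intro N _ f hf ℓ hℓ hℓ2
  exact oddShimuraQuotientCyclic_of_newform f hf hℓ hℓ2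

omit [NeZero N] [NeZero Q] in
/-- **LAW 52.6 (closed form): for every newform and every odd prime `ℓ`, `Λ₁(f) ⊄ ℓΛ₀(f)`.**  DISCHARGED below. -/
@[conjecture]
def Gamma1PeriodsNotInOddMultipleLaw : Prop :=
  ∀ (N : ℕ) [NeZero N] (f : CuspForm (Gamma0 N) 2), IsNewform0 f →
    ∀ ℓ : ℕ, ℓ.Prime → ℓ ≠ 2 → Gamma1PeriodsNotInOddMultiple f ℓ

omit [NeZero N] [NeZero Q] in
/-- `gamma1PeriodsNotInOddMultipleLaw_holds`: the closed-form law above HOLDS — discharged by the corresponding theorem of §3–§8. [folklore] -/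
theorem gamma1PeriodsNotInOddMultipleLaw_holds : Gamma1PeriodsNotInOddMultipleLaw := by
  intro N _ f hf ℓ hℓ hℓ2
  exact gamma1Periods_not_in_oddMultiple_of_newform f hf hℓ hℓ2

omit [NeZero N] [NeZero Q] in
/-- **LAW 52.5 (closed form): for every newform and every odd TRACELESS prime `ℓ ∣ N` (`T_ℓ f = 0`, e.g. `ℓ² ∣ N`), the `ℓ`-kernel of the
Shimura quotient has rank `≤ 1`.**  DISCHARGED below. -/
@[conjecture]
def OddShimuraKernelRankLeOneLaw : Prop :=
  ∀ (N : ℕ) [NeZero N] (f : CuspForm (Gamma0 N) 2), IsNewform0 f →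
    ∀ (ℓ : ℕ) [NeZero ℓ], ℓ.Prime → ℓ ≠ 2 → ℓ ∣ N → heckeT (Gamma0 N) 2 ℓ f = (0 : ℂ) • f →
      OddShimuraKernelRankLeOne f ℓ

omit [NeZero N] [NeZero Q] in
/-- `oddShimuraKernelRankLeOneLaw_holds`: the closed-form law above HOLDS — discharged by the corresponding theorem of §3–§8. [folklore] -/
theorem oddShimuraKernelRankLeOneLaw_holds : OddShimuraKernelRankLeOneLaw := by
  intro N _ f hf ℓ _ hℓ hℓ2 hℓN hT x hx y hy _ _
  exact oddKernel_rank_le_one_of_newform f hf hℓ hℓ2 hℓN hT hx hy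

omit [NeZero N] [NeZero Q] in
/-- **LAW 52.A′ (the PROFILE, closed form): for every newform, `2Λ₀(f) ⊄ Λ₁(f)` forces the Fricke sign `−1` (even analytic rank) and AT MOST ONE
Atkin–Lehner-minus prime.**  DISCHARGED below (`shimuraTwoProfileLaw_holds`, via §7 `two_mul_mem_of_two_atkinLehner_minus` and §7′). -/
@[conjecture]
def ShimuraTwoProfileLaw : Prop :=
  ∀ (N : ℕ) [NeZero N] (f : CuspForm (Gamma0 N) 2), IsNewform0 f →
    (¬ ∀ z ∈ periodLattice f, 2 * z ∈ periodLatticeGamma1 f) →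
      atkinLehnerInvolution N 2 N f = (-1 : ℂ) • f ∧
        ∀ q₁ ∈ N.primeFactors, ∀ q₂ ∈ N.primeFactors, atkinLehnerEigenvalueAt f q₁ = -1 →
          atkinLehnerEigenvalueAt f q₂ = -1 → q₁ = q₂

omit [NeZero N] [NeZero Q] in
/-- `shimuraTwoProfileLaw_holds`: the closed-form law above HOLDS — discharged by the corresponding theorem of §3–§8. [folklore] -/
theorem shimuraTwoProfileLaw_holds : ShimuraTwoProfileLaw := by
  intro N _ f hf h
  exact fricke_neg_and_unique_minus_of_not_two_mul_le f hf h

omit [NeZero N] [NeZero Q] in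
/-- **LAW 51.A (closed form): at a traceless prime `ℓ ∣ N` (`T_ℓ f = 0`) every real multiplier `x` of `Λ₁(f)` into `Λ₀(f)` has `ℓx ∈ mult Λ₀(f)`**
(`ℓ𝔛 ⊆ Õ`, NOTE-51 §1).  DISCHARGED below (`tracelessMultiplierLaw_holds`, from THEOREM W). -/
@[conjecture]
def TracelessMultiplierLaw : Prop :=
  ∀ (N : ℕ) [NeZero N] (f : CuspForm (Gamma0 N) 2) (ℓ : ℕ) [NeZero ℓ], ℓ.Prime → ℓ ∣ N →
    heckeT (Gamma0 N) 2 ℓ f = (0 : ℂ) • f →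
      ∀ x : ℂ, (∀ z ∈ periodLatticeGamma1 f, x * z ∈ periodLattice f) →
        ∀ z ∈ periodLattice f, ((ℓ : ℂ) * x) * z ∈ periodLattice f

omit [NeZero N] [NeZero Q] in
/-- `tracelessMultiplierLaw_holds`: the closed-form law above HOLDS — discharged by the corresponding theorem of §3–§8. [folklore] -/
theorem tracelessMultiplierLaw_holds : TracelessMultiplierLaw := by
  intro N _ f ℓ _ hℓ hℓN hT x hx
  exact mul_multiplier_of_traceless f hℓ hℓN hT hx

end Summit.BirchSwinnertonDyer.BirchSwinnertonDyer.Theorems.ManinLocalTwoThree.ShimuraQuotientCyclic
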